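import Summits.ValiantsHypothesis.ValiantsHypothesis.Theses.OneNatPerBit
import Literature.Computability.AlgebraicComplexity.ArithCircuitProofs
import Literature.Computability.AlgebraicComplexity.ValiantClasses
import Literature.Computability.AlgebraicComplexity.PermanentCorrelation

/-!
# ValiantsHypothesis / OneNatPerBit — `GapRefutesPer`

Route `OneNatPerBit`, item `stmt-ValiantsHypothesis-10322` (support, rank 9):
`CorrelationGap → ¬ IsVPFamily (fun n => perPoly (Fin n) ℂ)`.

Bookkeeping from tree results only:

* `IsVPFamily` gives a p-bounded complexity `L(per_n) ≤ n ^ c + c` (Bürgisser 2000, Def. 2.1–2.4),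
  and `ArithCircuit.exists_computes_size_eq_complexity` a fan-in-two circuit of exactly that size
  computing `per_n`; for `n ≥ 2` one has `n ^ c + c ≤ n ^ (c + 1)`.
* `CorrelationGap` at exponent `c + 1` and `n = max n₀ 2` then reads
  `2 · ‖permMass per_n‖² ≤ n! · coeffNormSq per_n`, and `permMass_perPoly`, `coeffNormSq_perPoly`
  (`Literature…PermanentCorrelation`) evaluate both sides: `2 · (n!)² ≤ (n!)²`, absurd.
-/

-- single-conjunct layout: Sub = Summit, duplicated namespace component intended
set_option linter.dupNamespace false

namespace Summit.ValiantsHypothesis.ValiantsHypothesis.Theorems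

open Literature.Computability.AlgebraicComplexity

/-- Settles `stmt-ValiantsHypothesis-10322` (`GapRefutesPer`, route `OneNatPerBit`): the correlation
gap at polynomial size refutes p-computability of the permanent family over `ℂ`. A p-computable
`per` has fan-in-two circuits of size `≤ n ^ c + c ≤ n ^ (c + 1)` computing `per_n` exactly
(Bürgisser 2000, Def. 2.1–2.4; attainment of `complexity`), whose output has permutation mass `n!`
and squared coefficient norm `n!`; the gap inequality `2 · (n!)² ≤ n! · n!` is impossible.
[cite: Burgisser2000, Def. 2.4] -/
theorem gapRefutesPer_proof :
    Summit.ValiantsHypothesis.ValiantsHypothesis.Theses.OneNatPerBit.GapRefutesPer := by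
  unfold Summit.ValiantsHypothesis.ValiantsHypothesis.Theses.OneNatPerBit.GapRefutesPer
    Summit.ValiantsHypothesis.ValiantsHypothesis.Theses.OneNatPerBit.CorrelationGap
  intro hX hVP
  obtain ⟨c, hc⟩ := hVP.2
  obtain ⟨n₀, hn₀⟩ := hX (c + 1)
  set n : ℕ := max n₀ 2 with hn
  have hn₀n : n₀ ≤ n := le_max_left _ _
  have h2n : 2 ≤ n := le_max_right _ _
  obtain ⟨P, hP2, hPc, hPs⟩ :=
    ArithCircuit.exists_computes_size_eq_complexity (perPoly (Fin n) ℂ)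
  have hsize : P.size ≤ n ^ (c + 1) := by
    rw [hPs]
    have hcn : c ≤ n ^ c :=
      (Nat.lt_two_pow_self).le.trans (Nat.pow_le_pow_left h2n c)
    calc complexity (perPoly (Fin n) ℂ) ≤ n ^ c + c := hc n
      _ ≤ n ^ c + n ^ c := Nat.add_le_add_left hcn _
      _ = 2 * n ^ c := by ring
      _ ≤ n * n ^ c := Nat.mul_le_mul_right _ h2n
      _ = n ^ (c + 1) := by ring
  have key := hn₀ n hn₀n P hP2 hsize
  have hPc' : P.eval = perPoly (Fin n) ℂ := hPc
  have h1 : ∑ σ : Equiv.Perm (Fin n), MvPolynomial.coeff (permMonomial σ) (perPoly (Fin n) ℂ) =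
      (n.factorial : ℂ) :=
    permMass_perPoly ℂ
  have h2 : (perPoly (Fin n) ℂ).support.sum
      (fun m => ‖MvPolynomial.coeff m (perPoly (Fin n) ℂ)‖ ^ 2) = (n.factorial : ℝ) :=
    coeffNormSq_perPoly (n := n) (R := ℂ)
  rw [hPc', h1, h2, Complex.norm_natCast] at key
  have hpos : (0 : ℝ) < n.factorial := by exact_mod_cast Nat.factorial_pos n
  nlinarith

end Summit.ValiantsHypothesis.ValiantsHypothesis.Theorems
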